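import Mathlib

/-!
# AtomicCalibrationR (stmt-QuantumFields-28169), E2 `stub_offDiagonalWhitney` — the shell summation lemma
# (Plan A step 6 "sum over dyadic r-shells with decay" of planner ym-idea-11 g15's `STUB-PLAN-offDiagonalWhitney.md`; prover w4 g22)

The abstract bookkeeping behind `Summable M ∧ Σ M_j ≤ …` in `WhitneyPkg` (vi): a non-negative family `w` on any index type whose
members sit at "radii" `N i ≥ 0`, with polynomially many indices per unit shell and polynomial decay two orders better, is summable
with an explicit bound.

* `sum_inv_succ_sq_le_two` — `Σ_{a ∈ t} 1/(1+a)² ≤ 2` for every finite `t ⊆ ℕ`;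
* `sum_le_of_shell_count` — for every finite `s`: `Σ_{i ∈ s} w i ≤ 2^{D+1} A B` provided `#{i | ⌊N i⌋₊ = a} ≤ A (2+a)^D` and
  `w i ≤ B/(1 + N i)^{D+2}`;
* `summable_of_shell_count`, `tsum_le_of_shell_count` — hence `Summable w` and `Σ' w ≤ 2^{D+1} A B`.

(Use: `I` = the pieces, `N` = `‖centre‖`, the count from `AtomicCalibrationRBandBridge.ncard_near_le` per band, the decay from
`AtomicCalibrationRWhitneyBookkeeping`.)  Mathlib only; no stub/crux/rung/summit is closed; nothing here touches Yang–Mills; the YM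
mass gap is NOT proved. [folklore]
-/

set_option autoImplicit false

noncomputable section

open scoped BigOperators

namespace Summit.QuantumFields.YangMills.Cruxes.AtomicCalibrationR.ShellSum

/-- `Σ_{a ∈ t} 1/(1+a)² ≤ 2` for every finite set of naturals. -/
theorem sum_inv_succ_sq_le_two (t : Finset ℕ) : ∑ a ∈ t, 1 / ((1 : ℝ) + a) ^ 2 ≤ 2 := by
  classical
  -- enlarge `t` to a range, then shift to `Ioo 0 (T+1)` and use `sum_Ioo_inv_sq_le`
  obtain ⟨T, hT⟩ : ∃ T : ℕ, ∀ a ∈ t, a < T := ⟨t.sup id + 1, fun a ha => Nat.lt_succ_of_le (Finset.le_sup (f := id) ha)⟩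
  have hsub : t ⊆ Finset.range T := fun a ha => Finset.mem_range.2 (hT a ha)
  have h1 : ∑ a ∈ t, 1 / ((1 : ℝ) + a) ^ 2 ≤ ∑ a ∈ Finset.range T, 1 / ((1 : ℝ) + a) ^ 2 :=
    Finset.sum_le_sum_of_subset_of_nonneg hsub fun a _ _ => by positivity
  refine h1.trans ?_
  have h2 : ∑ a ∈ Finset.range T, 1 / ((1 : ℝ) + a) ^ 2 = ∑ i ∈ Finset.Ioo 0 (T + 1), ((i : ℝ) ^ 2)⁻¹ := by
    have hmap : Finset.Ioo 0 (T + 1) = (Finset.range T).map ⟨fun a => a + 1, fun a b h => by simpa using h⟩ := by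
      ext i
      simp only [Finset.mem_Ioo, Finset.mem_map, Finset.mem_range, Function.Embedding.coeFn_mk]
      constructor
      · rintro ⟨h0, h1⟩; exact ⟨i - 1, by omega, by omega⟩
      · rintro ⟨a, ha, rfl⟩; exact ⟨by omega, by omega⟩
    rw [hmap, Finset.sum_map]
    refine Finset.sum_congr rfl fun a _ => ?_
    simp only [Function.Embedding.coeFn_mk, one_div]
    push_cast
    ring
  rw [h2]
  have h3 := sum_Ioo_inv_sq_le (α := ℝ) 0 (T + 1)
  norm_num at h3
  exact h3

variable {I : Type*}

/-- **Shell summation, finite form.**  If the indices with `⌊N i⌋₊ = a` number at most `A (2+a)^D` and `0 ≤ w i ≤ B/(1+N i)^{D+2}`,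
then every finite partial sum of `w` is `≤ 2^{D+1} A B` (no sign condition on `w` needed here). -/
theorem sum_le_of_shell_count (N w : I → ℝ) (hN : ∀ i, 0 ≤ N i) {A B : ℝ} {D : ℕ} (hA : 0 ≤ A)
    (hB : 0 ≤ B) (hfin : ∀ a : ℕ, {i | ⌊N i⌋₊ = a}.Finite)
    (hcount : ∀ a : ℕ, (({i | ⌊N i⌋₊ = a}.ncard : ℕ) : ℝ) ≤ A * (2 + a) ^ D)
    (hw : ∀ i, w i ≤ B / (1 + N i) ^ (D + 2)) (s : Finset I) :
    ∑ i ∈ s, w i ≤ 2 ^ (D + 1) * A * B := by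
  classical
  -- split the sum along the shells `⌊N i⌋₊ = a`
  let t : Finset ℕ := s.image fun i => ⌊N i⌋₊
  rw [← Finset.sum_fiberwise_of_maps_to (s := s) (t := t) (g := fun i => ⌊N i⌋₊)
    (fun i hi => Finset.mem_image_of_mem _ hi) w]
  -- each shell contributes at most `2^D A B /(1+a)²`
  have hshell : ∀ a ∈ t, ∑ i ∈ s with ⌊N i⌋₊ = a, w i ≤ 2 ^ D * A * B * (1 / ((1 : ℝ) + a) ^ 2) := by
    intro a _
    have hcard : (((s.filter fun i => ⌊N i⌋₊ = a).card : ℕ) : ℝ) ≤ A * (2 + a) ^ D := by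
      refine le_trans ?_ (hcount a)
      have hsub : ((s.filter fun i => ⌊N i⌋₊ = a) : Set I) ⊆ {i | ⌊N i⌋₊ = a} := fun i hi => by
        have := (Finset.mem_filter.1 (Finset.mem_coe.1 hi)).2; exact this
      have := Set.ncard_le_ncard hsub (hfin a)
      rw [Set.ncard_coe_finset] at this
      exact_mod_cast this
    have hterm : ∀ i ∈ s.filter (fun i => ⌊N i⌋₊ = a), w i ≤ B / ((1 : ℝ) + a) ^ (D + 2) := by
      intro i hi
      have hia : ⌊N i⌋₊ = a := (Finset.mem_filter.1 hi).2
      refine (hw i).trans ?_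
      have hle : (1 : ℝ) + a ≤ 1 + N i := by
        have := Nat.floor_le (hN i); rw [hia] at this; linarith
      exact div_le_div_of_nonneg_left hB (by positivity) (pow_le_pow_left₀ (by positivity) hle _)
    calc ∑ i ∈ s with ⌊N i⌋₊ = a, w i ≤ (s.filter fun i => ⌊N i⌋₊ = a).card • (B / ((1 : ℝ) + a) ^ (D + 2)) :=
          Finset.sum_le_card_nsmul _ _ _ hterm
      _ = ((s.filter fun i => ⌊N i⌋₊ = a).card : ℝ) * (B / ((1 : ℝ) + a) ^ (D + 2)) := nsmul_eq_mul _ _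
      _ ≤ A * (2 + a) ^ D * (B / ((1 : ℝ) + a) ^ (D + 2)) :=
          mul_le_mul_of_nonneg_right hcard (by positivity)
      _ ≤ A * (2 * (1 + a)) ^ D * (B / ((1 : ℝ) + a) ^ (D + 2)) := by
          refine mul_le_mul_of_nonneg_right (mul_le_mul_of_nonneg_left
            (pow_le_pow_left₀ (by positivity) (by linarith) D) hA) (by positivity)
      _ = 2 ^ D * A * B * (1 / ((1 : ℝ) + a) ^ 2) := by
          have h1a : (0 : ℝ) < 1 + a := by positivity
          have hD : ((1 : ℝ) + a) ^ (D + 2) = ((1 : ℝ) + a) ^ D * ((1 : ℝ) + a) ^ 2 := pow_add _ _ _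
          rw [mul_pow, hD]
          field_simp
  calc ∑ a ∈ t, ∑ i ∈ s with ⌊N i⌋₊ = a, w i ≤ ∑ a ∈ t, 2 ^ D * A * B * (1 / ((1 : ℝ) + a) ^ 2) :=
        Finset.sum_le_sum hshell
    _ = 2 ^ D * A * B * ∑ a ∈ t, 1 / ((1 : ℝ) + a) ^ 2 := by rw [Finset.mul_sum]
    _ ≤ 2 ^ D * A * B * 2 := mul_le_mul_of_nonneg_left (sum_inv_succ_sq_le_two t) (by positivity)
    _ = 2 ^ (D + 1) * A * B := by rw [pow_succ]; ring

/-- **Shell summation**: under the hypotheses of `sum_le_of_shell_count`, `w` is summable. -/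
theorem summable_of_shell_count (N w : I → ℝ) (hN : ∀ i, 0 ≤ N i) (hw0 : ∀ i, 0 ≤ w i) {A B : ℝ} {D : ℕ} (hA : 0 ≤ A)
    (hB : 0 ≤ B) (hfin : ∀ a : ℕ, {i | ⌊N i⌋₊ = a}.Finite)
    (hcount : ∀ a : ℕ, (({i | ⌊N i⌋₊ = a}.ncard : ℕ) : ℝ) ≤ A * (2 + a) ^ D)
    (hw : ∀ i, w i ≤ B / (1 + N i) ^ (D + 2)) : Summable w :=
  summable_of_sum_le hw0 (sum_le_of_shell_count N w hN hA hB hfin hcount hw)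

/-- **Shell summation**: … and `Σ' w ≤ 2^{D+1} A B`. [folklore] -/
theorem tsum_le_of_shell_count (N w : I → ℝ) (hN : ∀ i, 0 ≤ N i) (hw0 : ∀ i, 0 ≤ w i) {A B : ℝ} {D : ℕ} (hA : 0 ≤ A)
    (hB : 0 ≤ B) (hfin : ∀ a : ℕ, {i | ⌊N i⌋₊ = a}.Finite)
    (hcount : ∀ a : ℕ, (({i | ⌊N i⌋₊ = a}.ncard : ℕ) : ℝ) ≤ A * (2 + a) ^ D)
    (hw : ∀ i, w i ≤ B / (1 + N i) ^ (D + 2)) : ∑' i, w i ≤ 2 ^ (D + 1) * A * B :=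
  Real.tsum_le_of_sum_le hw0 (sum_le_of_shell_count N w hN hA hB hfin hcount hw)

end Summit.QuantumFields.YangMills.Cruxes.AtomicCalibrationR.ShellSum

end
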